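import Mathlib

/-!
# Zhang (2022): the subconvex input of Lemma 3.2 — contour-shift threshold and exponent rows

Trunk T-ANT (NumberTheory/LFunctions). Y. Zhang, *Discrete mean estimates and the Landau–Siegel
zero*, arXiv:2211.02515v1 (2022) [Zhang2022LandauSiegel], §3: Lemmas 3.1, 3.2, 3.6, and their
consumers (7.5)/(14.3). **Status of the source: an unrefereed manuscript, a claimed result under
adjudication** (audit + repair census of arXiv:2211.02515; no claim about Landau–Siegel is made
here).

WHAT ENTERS WHERE. The only place in the manuscript where a bound for the SIZE of `L(s,χ)` below
the convexity bound is needed is the contour shift in the sketched proof of Lemma 3.2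
[p. 7 of the source]: the generating function of `ν²τ₂²` is `ζ(s)⁸L(s,χ)⁸φ*(s)`, and the kernel
`(D^{8s} − D^{4s})Γ(s)` must beat `L(1+s,χ)⁸` on a line `Re s = −η`. With
`|L(1−η+it,χ)| ≪ D^{2μη+ε}` (Phragmén–Lindelöf interpolation from an exponent `μ` at `σ = ½`:
convexity `μ = ¼`; Burgess `μ = 3/16` [IwaniecKowalski2004, Thm 12.9; Burgess1963CharacterSumsII];
Weyl strength `μ = 1/6` [PetrowYoung2023, Thm 1.1; for real `χ` ConreyIwaniec2000]) the shifted
integral of `Φ(1+s)ζ(1+s)^k L(1+s,χ)^k D^{as}Γ(s)` is `O(D^{−(a − 2kμ)η + ε})`: a power saving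
**iff `2kμ < a`** (`Saves`). The residue at `s = 0` is then bounded on the circle `|s| = α*`,
`α* = 𝓛^{-a*}` (`𝓛 = log D`, printed `a* = A + 2 = 2024`), by
`ζ(1+s)^k ≪ 𝓛^{k a*}`, `L(1+s,χ)^k ≪ 𝓛^{-k·min(A, a*−2)}` (hypothesis (A): `L(1,χ) < 𝓛^{-A}`,
`A = 2022`), kernel·`Γ(s) ≪ 𝓛^{e_K}` (`e_K = 1` for the cut `D⁴`, `e_K = 9` for the cut
`P = exp 𝓛⁹` of Lemma 3.1) and the length `𝓛^{-a*}`: the residue is `≪ 𝓛^{-residueExp}`.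

This file PROVES the elementary rational arithmetic behind the cell's ALT-1 rows (repair-census
row V17; `HOME/b2b-zhang-alt-1/ALT-1.md` §§2–4, constraint rows `T-ALT1a … T-ALT1i`):
* the threshold instances: Lemma 3.1 saves with convexity (`2·2·¼ = 1 < 4`); Lemma 3.2 saves iff
  `μ < ¼` — with Burgess or Weyl strength, NOT with convexity at the printed cut `D⁴`
  (`16·¼ = 4 ≮ 4`), but again with convexity at a cut `D⁵`; the hybrid (`t`-aspect) thresholds of
  the transfer scenario `χ ↦ χ·n^{-it₁}`, `|t₁| ≤ D^{c}`;
* the residue exponents `2011` (Lemma 3.1, printed (3.2)), `2007` (Lemma 3.2, printed) and `2015`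
  for the four-factor generating function `ζ⁴L⁴` of `ν²τ₂` (the cell's Lemma 3.2♭), whose cut `D⁴`
  lies inside the convexity range (`2·4·¼ = 2 < 4`);
* **A11** (no subconvex input): with `E := ∑_{D⁴<n≤D⁸} ς(n)²/n ≤ 4·(∑_{D⁴<n≤D⁸} τ₂ν²/n)·(∑_{n≤D⁴} τ₂³/n)`
  (`Section3SigmaSplitting.sum_sigma_sq_div_le_source_tau_cubed`) and `∑_{n≤x} τ₂³/n ≍ (log x)⁸`,
  the exponent is `2015 − 8 = 2007`, the printed one, for EVERY `A` at `a* = A + 2`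
  (`a11_exponent_eq`), and never smaller for any `a*` (`residueExp_eight_le`);
* **A8** (the naive input-free substitute keeping the majorant `|ς| ≤ ντ₂`: Cauchy against (3.2)
  and `∑_{n≤D⁸} τ₂⁶/n ≍ 𝓛⁶⁴`): exponent `(A − 75)/2 = 973.5` at `A = 2022`, which does not feed
  Prop. 2.1 through (3.6) and (7.5)/(14.3) (`E ≤ e − 2 − 2·633`, `E > 3·68 + 57·9 = 717`, cf.
  `ExponentLayer.AdmissibleA`); it would from `A = 4046` on (`a8_feeds_iff`); the Hölder family of
  the cell's typer-I note reaches at most `≈ 1290 < 1985` at `A = 2022`.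
NOT formalised here (analytic, by hand in ALT-1.md §4 (3), re-derived by the cell's referee-2):
the contour shift itself, the Phragmén–Lindelöf interpolation, the literature bounds (they enter
only as the rational exponents `3/16`, `1/6`, `1/4`), and `∑ τ₂ν²/n ≪ 𝓛^{-2015}` under (A).
None of this bears on the cell's verdict: the closing inequality of §§8–18 fails for every `A` and
contains no parameter of this layer (`Section2AllIota.not_mainOrderContradictionG_all`,
`Section8Certificate.not_ineq824`). No statement about Theorems 1–2 of the source is made or
implied.
-/

namespace Literature.NumberTheory.LFunctions.Zhang2022.Section3SubconvexInput

/-! ### The saving rule of the contour shift -/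

/-- The contour-shift saving rule: shifting `∫ Φ(1+s)ζ(1+s)^k L(1+s,χ)^k D^{as}Γ(s) ds` from
`Re s = 1` to `Re s = −η` with `|L(1−η+it,χ)| ≪ D^{2μη+ε}` costs `O(D^{−(a−2kμ)η+ε})`, a power
saving iff `2kμ < a` (`k` = number of `L`-factors, `D^a` = the cut, `μ` = the exponent of `D` in
the bound for `L(½+it,χ)`). [cite: Zhang2022LandauSiegel, Lemma 3.1 proof and Lemma 3.2 sketch] -/
def Saves (k : ℕ) (a μ : ℚ) : Prop := 2 * (k : ℚ) * μ < a

/-- Lemma 3.1 (`ν²`, generating function `ζ²L²`, cut `D⁴`): convexity `μ = ¼` saves,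
`2·2·¼ = 1 < 4` (row T-ALT1a; "standard estimates" suffice, as printed).
[cite: Zhang2022LandauSiegel, Lemma 3.1] -/
theorem saves_lemma31_convexity : Saves 2 4 (1 / 4) := by
  norm_num [Saves]

/-- Lemma 3.2 (`ν²τ₂²`, generating function `ζ⁸L⁸`, cut `D⁴`) saves iff `μ < ¼`, i.e. iff SOME
`q`-aspect subconvex bound is used (rows I-L3.2b, T-F7, T-ALT1b: `8μ < cF/2` at `cF = 4`).
[cite: Zhang2022LandauSiegel, Lemma 3.2] -/
theorem saves_lemma32_iff (μ : ℚ) : Saves 8 4 μ ↔ μ < 1 / 4 := by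
  simp only [Saves]
  push_cast
  constructor <;> intro h <;> linarith

/-- Variant A1: the Burgess exponent `3/16` saves in Lemma 3.2 (`16·3/16 = 3 < 4`, error
`O(D^{-η+ε})`). The bound `L(½+it,χ) ≪ |s| q^{3/16+ε}` for primitive `χ mod q`:
[cite: IwaniecKowalski2004, Thm 12.9] (from Burgess's character-sum estimates). -/
theorem saves_lemma32_burgess : Saves 8 4 (3 / 16) := by
  norm_num [Saves]

/-- Variant A3: Weyl strength `1/6` saves in Lemma 3.2 (`16/6 = 8/3 < 4`, error
`O(D^{-(4/3)η+ε})`, row T-ALT1d). The bound `L(½+it,χ) ≪_ε (q(1+|t|))^{1/6+ε}` for every primitive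
`χ`: [cite: PetrowYoung2023, Thm 1.1]; for real primitive `χ` of odd squarefree conductor already
Conrey–Iwaniec (2000). -/
theorem saves_lemma32_weyl : Saves 8 4 (1 / 6) := by
  norm_num [Saves]

/-- Variant A5: convexity `μ = ¼` does NOT save in Lemma 3.2 at the printed cut `D⁴`
(`16·¼ = 4 ≮ 4`: the `D^{4s}`-piece of the shifted integral has `D`-exponent `0`) — refuted as a
substitution, a statement about the route, not about the lemma (row T-ALT1c). [folklore] -/
theorem not_saves_lemma32_convexity : ¬ Saves 8 4 (1 / 4) := by
  norm_num [Saves]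

/-- Variant A6: convexity saves again after the design change `D⁴ → D⁵` of the lengths of `F, G`
(`16·¼ = 4 < 5`), and more generally at a cut `D^{c_F}` iff `4 < c_F`. [folklore] -/
theorem saves_lemma32_convexity_cut_iff (cF : ℚ) : Saves 8 cF (1 / 4) ↔ 4 < cF := by
  simp only [Saves]
  push_cast
  constructor <;> intro h <;> linarith

/-- Variant A6, bookkeeping price (row I-L4.1b): in Lemma 4.1 the factor
`x^{|σ−σ₀|} ≤ (D^{c_F·20})^{log 𝓛/(100𝓛)} = 𝓛^{c_F·20/100}` must stay below `𝓛₁·𝓛/𝓛₁ = 𝓛^{406−405}`;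
this holds iff `c_F ≤ 5` (margin `0` at `c_F = 5`; `c_F = 6` breaks the row as typed).
[cite: Zhang2022LandauSiegel, Lemma 4.1] -/
theorem lemma41_cut_iff (cF : ℚ) : 405 + cF * 20 / 100 ≤ 406 ↔ cF ≤ 5 := by
  constructor <;> intro h <;> linarith

/-- Variant A11's generating function (`ν²τ₂`, four factors `ζ⁴L⁴`, cut `D⁴`): convexity saves,
`2·4·¼ = 2 < 4` — the cut `D⁴` exceeds the square root `D²` of the conductor of `L⁴`
(row T-ALT1f, the cell's Lemma 3.2♭). [folklore] -/
theorem saves_lemma32flat_convexity : Saves 4 4 (1 / 4) := by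
  norm_num [Saves]

/-- Transfer scenario `χ ↦ χ·n^{-it₁}`, `|t₁| ≤ D^{c}` (row T-ALT1e): with a HYBRID bound of
exponent `μ_h` in `q(1+|t|)` the requirement becomes `2k·μ_h·(1+c) < a`. Hybrid Burgess
(`μ_h = 3/16`, Heath-Brown 1978) keeps the manuscript's route (`k = 8`, `a = 4`) valid iff
`c < 1/3`. [folklore] -/
theorem saves_transfer_burgess_iff (c : ℚ) : Saves 8 4 (3 / 16 * (1 + c)) ↔ c < 1 / 3 := by
  simp only [Saves]
  push_cast
  constructor <;> intro h <;> linarith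

/-- Transfer with hybrid Weyl strength (`μ_h = 1/6`, [cite: PetrowYoung2023, Thm 1.1]): the
manuscript's route stays valid iff `c < 1/2`. -/
theorem saves_transfer_weyl_iff (c : ℚ) : Saves 8 4 (1 / 6 * (1 + c)) ↔ c < 1 / 2 := by
  simp only [Saves]
  push_cast
  constructor <;> intro h <;> linarith

/-- Transfer on the A11 route (`k = 4`, hybrid convexity `μ_h = ¼`, no literature at all): valid
iff `c < 1`. [folklore] -/
theorem saves_transfer_flat_iff (c : ℚ) : Saves 4 4 (1 / 4 * (1 + c)) ↔ c < 1 := by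
  simp only [Saves]
  push_cast
  constructor <;> intro h <;> linarith

/-! ### Residue bookkeeping on the circle `|s| = α* = 𝓛^{-a*}` -/

/-- The residue exponent: on `|s| = 𝓛^{-a*}`, `ζ(1+s)^k ≪ 𝓛^{k a*}`,
`L(1+s,χ)^k ≪ 𝓛^{-k·min(A, a*−2)}` (from (A) and `L′ ≪ 𝓛²` near `1`), kernel·`Γ(s) ≪ 𝓛^{e_K}`,
length `≪ 𝓛^{-a*}`, so the residue is `≪ 𝓛^{-residueExp k A a* e_K}` with
`residueExp = k·min(A, a*−2) − (k−1)·a* − e_K`.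
[cite: Zhang2022LandauSiegel, Lemma 3.1 proof] -/
def residueExp (k : ℕ) (A astar eK : ℚ) : ℚ :=
  (k : ℚ) * min A (astar - 2) - ((k : ℚ) - 1) * astar - eK

/-- Lemma 3.1 as printed: `k = 2`, `A = 2022`, `a* = 2024`, kernel `(P^{2s} − D^{4s})Γ(s) ≪ 𝓛⁹`:
exponent `2011` = (3.2). [cite: Zhang2022LandauSiegel, (3.2)] -/
theorem residueExp_lemma31 : residueExp 2 2022 2024 9 = 2011 := by
  norm_num [residueExp]

/-- Lemma 3.2 as printed: `k = 8`, kernel `(D^{8s} − D^{4s})Γ(s) ≪ 𝓛`: exponent `2007`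
(parameter `e3b`). [cite: Zhang2022LandauSiegel, Lemma 3.2] -/
theorem residueExp_lemma32 : residueExp 8 2022 2024 1 = 2007 := by
  norm_num [residueExp]

/-- The cell's Lemma 3.2♭ (`ν²τ₂`, `ζ⁴L⁴`, same kernel): exponent `2015` (parameter `e3f`,
row T-ALT1g). [folklore] -/
theorem residueExp_lemma32flat : residueExp 4 2022 2024 1 = 2015 := by
  norm_num [residueExp]

/-- At the manuscript's choice `a* = A + 2` the residue exponent is linear in `A`:
`A + 2 − 2k − e_K` (so `e32 = A − 11`, `e3b = A − 15`, `e3f = A − 7`). [folklore] -/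
theorem residueExp_astar (k : ℕ) (A eK : ℚ) :
    residueExp k A (A + 2) eK = A + 2 - 2 * k - eK := by
  simp only [residueExp, add_sub_cancel_right, min_self]
  ring

/-! ### A11: no subconvex input, the printed exponent exactly -/

/-- A11's exponent: `E ≤ 4·V·U` with `V ≪ 𝓛^{-e3f}` and `U = ∑_{n≤D⁴} τ₂³/n ≪ 𝓛⁸`
(`∑_{n≤x} τ₂(n)³/n ≍ (log x)^{2³}`) gives `E ≪ 𝓛^{-(e3f − 8)}`, and `e3f − 8 = e3b` for EVERY `A`
at `a* = A + 2`: the route without subconvexity reproduces the printed right side of Lemma 3.2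
exactly (row T-ALT1h, `holds-tight`). [folklore] -/
theorem a11_exponent_eq (A : ℚ) : residueExp 4 A (A + 2) 1 - 8 = residueExp 8 A (A + 2) 1 := by
  rw [residueExp_astar, residueExp_astar]
  push_cast
  ring

/-- … and for ANY radius exponent `a*` the eight-factor route is never better:
`residueExp 8 ≤ residueExp 4 − 8`, because `min(A, a*−2) ≤ a* − 2`. [folklore] -/
theorem residueExp_eight_le (A astar : ℚ) :
    residueExp 8 A astar 1 ≤ residueExp 4 A astar 1 - 8 := by
  simp only [residueExp]
  have hm : min A (astar - 2) ≤ astar - 2 := min_le_right _ _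
  push_cast
  linarith

/-- … with equality iff `a* − 2 ≤ A` (the printed `a* = A + 2` is the equality case). [folklore] -/
theorem residueExp_eight_eq_iff (A astar : ℚ) :
    residueExp 8 A astar 1 = residueExp 4 A astar 1 - 8 ↔ astar - 2 ≤ A := by
  simp only [residueExp]
  push_cast
  constructor
  · intro h
    have hm : min A (astar - 2) = astar - 2 := by linarith
    exact min_eq_right_iff.mp hm
  · intro h
    rw [min_eq_right h]
    ring

/-! ### Feeding Prop. 2.1: rows (3.6) and (7.5)/(14.3) -/

/-- An exponent `e` in the role of `e3b` (`∑_{D⁴<n≤D⁸}(majorant of ς²)/n ≪ 𝓛^{-e}`) feeds Prop. 2.1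
with exceptional-set exponent `E` iff (3.6): `E ≤ e − 2 − 2·633` (Cauchy with Lemma 3.1 costs `𝓛²`,
the threshold `𝓛^{-633}` of (3.6) costs `2·633`) and (7.5)/(14.3): `E > 3·68 + 57·9 = 717`
(cf. `ExponentLayer.AdmissibleA`, rows (3.6) and (7.5)).
[cite: Zhang2022LandauSiegel, Lemma 3.6 and (7.5)] -/
def FeedsProp21 (e E : ℚ) : Prop := E ≤ e - 2 - 2 * 633 ∧ (3 * 68 + 57 * 9 : ℚ) < E

/-- The printed point: `e3b = 2007` feeds Prop. 2.1 with `E = 739`.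
[cite: Zhang2022LandauSiegel, Lemma 3.6] -/
theorem feedsProp21_printed : FeedsProp21 2007 739 := by
  norm_num [FeedsProp21]

/-- An exponent `e` feeds Prop. 2.1 for some `E` iff `e > 1985` (witness `E = e − 1268`).
[folklore] -/
theorem feedsProp21_iff (e : ℚ) : (∃ E, FeedsProp21 e E) ↔ 1985 < e := by
  constructor
  · rintro ⟨E, h₁, h₂⟩
    norm_num at h₂
    linarith
  · intro he
    exact ⟨e - 1268, by linarith, by linarith⟩

/-! ### A8: the naive input-free substitute is too weak at the printed `A` -/

/-- Variant A8 (Cauchy against (3.2), keeping the manuscript's majorant `|ς| ≤ ντ₂`):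
`∑_{D⁴<n≤D⁸} ν²τ₂²/n ≤ (∑_{D⁴<n≤P} ν²/n)^{1/2}(∑_{n≤D⁸} τ₂⁶/n)^{1/2} ≪ 𝓛^{-(e32/2 − 32)}` with
`e32 = residueExp 2 A (A+2) 9 = A − 11` and `∑_{n≤x} τ₂⁶/n ≍ (log x)^{64}`: the substitute exponent
(row T-ALT1i). [folklore] -/
def e3bNaive (A : ℚ) : ℚ := residueExp 2 A (A + 2) 9 / 2 - 32

/-- A8 at the printed `A = 2022`: exponent `1947/2 = 973.5` (ALT-1 results: `e3b 2007 → 1947/2`,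
`x36 739 → −589/2`). [folklore] -/
theorem e3bNaive_printed : e3bNaive 2022 = 1947 / 2 := by
  norm_num [e3bNaive, residueExp]

/-- In general `e3bNaive A = (A − 75)/2`. [folklore] -/
theorem e3bNaive_eq (A : ℚ) : e3bNaive A = (A - 75) / 2 := by
  rw [e3bNaive, residueExp_astar]
  push_cast
  ring

/-- A8 does not feed Prop. 2.1 at the printed `A = 2022` (`973.5 ≤ 1985`): refuted-with-reason as a
repair of the exponent block — the substitute is weaker in the binding direction. [folklore] -/
theorem a8_not_feeds_printed : ¬ ∃ E, FeedsProp21 (e3bNaive 2022) E := by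
  rw [feedsProp21_iff, e3bNaive_printed]
  norm_num

/-- A8 feeds Prop. 2.1 iff `A > 4045`: the least admissible INTEGER is `A = 4046` (the value the
cell's sweep engine reports for the variant file `CONSTRAINTS.alt1-A8-naive-hoelder.json`).
[folklore] -/
theorem a8_feeds_iff (A : ℚ) : (∃ E, FeedsProp21 (e3bNaive A) E) ↔ 4045 < A := by
  rw [feedsProp21_iff, e3bNaive_eq]
  constructor <;> intro h <;> linarith

/-- The witness at `A = 4046`: `E = 717.5 = 1435/2`. [folklore] -/
theorem a8_feeds_4046 : FeedsProp21 (e3bNaive 4046) (1435 / 2) := by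
  rw [e3bNaive_eq]
  norm_num [FeedsProp21]

/-- … and `A = 4045` does not feed for any `E`. [folklore] -/
theorem a8_not_feeds_4045 : ¬ ∃ E, FeedsProp21 (e3bNaive 4045) E := by
  rw [a8_feeds_iff]
  norm_num

/-- The Hölder family of input-free substitutes keeping `|ς| ≤ ντ₂` (the cell's typer-I note):
`∑ ν²τ₂²/n ≤ (∑ ν²/n)^{1−θ}(∑ ν²τ₂^{2/θ}/n)^θ ≪ 𝓛^{-((1−θ)·2011 − θ·2^{2+j})}` at `A = 2022`, where
`j = 2/θ ∈ ℕ` and `∑_{n≤x} τ₂(n)^{2+j}/n ≍ (log x)^{2^{2+j}}`. [folklore] -/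
def hoelderExp (θ : ℚ) (j : ℕ) : ℚ := (1 - θ) * 2011 - θ * 2 ^ (2 + j)

/-- The indices used below: `2/θ = j` for `θ = 1/2, 1/3, 2/5, 2/7`. [folklore] -/
theorem hoelder_indices :
    (2 : ℚ) / (1 / 2) = 4 ∧ (2 : ℚ) / (1 / 3) = 6 ∧ (2 : ℚ) / (2 / 5) = 5 ∧ (2 : ℚ) / (2 / 7) = 7 := by
  norm_num

/-- The family's values at `A = 2022`: `θ = 1/2`: `973.5` (= A8); `θ = 1/3`: `3766/3 ≈ 1255.3`;
`θ = 2/5`: `5777/5 = 1155.4`; `θ = 2/7`: `9031/7 ≈ 1290.1` (the best of the family, `θ ≈ 0.285`).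
[folklore] -/
theorem hoelder_family_values :
    hoelderExp (1 / 2) 4 = 1947 / 2 ∧ hoelderExp (1 / 3) 6 = 3766 / 3 ∧
      hoelderExp (2 / 5) 5 = 5777 / 5 ∧ hoelderExp (2 / 7) 7 = 9031 / 7 := by
  norm_num [hoelderExp]

/-- None of them feeds Prop. 2.1 at the printed `A` (all `≤ 1985`; the best misses by `> 694`
powers of `𝓛`). [folklore] -/
theorem hoelder_family_not_feeds :
    (¬ ∃ E, FeedsProp21 (hoelderExp (1 / 2) 4) E) ∧ (¬ ∃ E, FeedsProp21 (hoelderExp (1 / 3) 6) E) ∧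
      (¬ ∃ E, FeedsProp21 (hoelderExp (2 / 5) 5) E) ∧
        ¬ ∃ E, FeedsProp21 (hoelderExp (2 / 7) 7) E := by
  refine ⟨?_, ?_, ?_, ?_⟩ <;> rw [feedsProp21_iff] <;> norm_num [hoelderExp]

/-- Summary of the input axis at the printed `A = 2022` (repair-census row V17, exponent side):
the manuscript's route saves iff a subconvex exponent is used, A11 needs none and reproduces
`2007`, which feeds Prop. 2.1 with the printed `E = 739`; the naive substitute does not.
[folklore] -/
theorem v17_exponent_side :
    (∀ μ : ℚ, Saves 8 4 μ ↔ μ < 1 / 4) ∧ Saves 4 4 (1 / 4) ∧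
      residueExp 4 2022 2024 1 - 8 = residueExp 8 2022 2024 1 ∧
        FeedsProp21 (residueExp 8 2022 2024 1) 739 ∧ ¬ ∃ E, FeedsProp21 (e3bNaive 2022) E :=
  ⟨saves_lemma32_iff, saves_lemma32flat_convexity, by norm_num [residueExp],
    by rw [residueExp_lemma32]; exact feedsProp21_printed, a8_not_feeds_printed⟩

end Literature.NumberTheory.LFunctions.Zhang2022.Section3SubconvexInput
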